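import Mathlib.Analysis.Calculus.MeanValue
import Mathlib.Analysis.Calculus.ContDiff.Comp
import Mathlib.Analysis.Calculus.Deriv.Mul
import Mathlib.Analysis.Calculus.Deriv.Pow
import Mathlib.Analysis.Normed.Group.Bounded
import Mathlib.Topology.UniformSpace.HeineCantor
import HarnessLib

/-!
# Second-order Taylor expansion along segments with a uniform remainder

Trunk T-ANALYSIS (Literature/Analysis/Calculus). For a `C²` function `f : E → ℝ` on a real normed
space, the second-order Taylor expansion at `y` in the direction `Δ`,
`f(y + Δ) = f(y) + Df(y)Δ + ½ D²f(y)[Δ,Δ] + R`, with the remainder controlled by the OSCILLATION of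
the second derivative along the segment, `|R| ≤ (sup_{σ∈[0,1]} ‖D²f(y+σΔ) - D²f(y)‖) ‖Δ‖²`
(two applications of the mean value inequality to `τ ↦ f(y + τΔ)`; no third derivative), and its
consequences for `C²` functions with compact support: global bounds of `f, Df, D²f` and a remainder
`|R| ≤ ε‖Δ‖²` for `‖Δ‖ ≤ ρ(ε)` UNIFORMLY in `y` (uniform continuity of `D²f`). This is the
deterministic Taylor step of generator / Itô-type one-step estimates.

* `Literature.Analysis.Calculus.taylor_two_segment` — the expansion with the oscillation bound.
* `Literature.Analysis.Calculus.exists_forall_norm_le_of_hasCompactSupport` (`f`, `Df`, `D²f` bounded) and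
  `Literature.Analysis.Calculus.taylor_two_uniform` — the uniform `ε‖Δ‖²` remainder for `C²_c` functions.

## References

* H. Cartan, *Calcul différentiel* (1967), Thm 5.6.3 (Taylor's formula with the mean value
  inequality). [folklore]
-/

noncomputable section

open Set Filter Topology Metric

namespace Literature.Analysis.Calculus

variable {E : Type*} [NormedAddCommGroup E] [NormedSpace ℝ E]

/-- The segment map `τ ↦ y + τ • Δ` has derivative `Δ`. [folklore] -/
theorem hasDerivAt_lineSegment (y Δ : E) (τ : ℝ) : HasDerivAt (fun σ : ℝ => y + σ • Δ) Δ τ := by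
  simpa using ((hasDerivAt_id τ).smul_const Δ).const_add y

/-- Along the segment, `τ ↦ f(y + τΔ)` has derivative `Df(y + τΔ)Δ`. [folklore] -/
theorem hasDerivAt_comp_lineSegment {f : E → ℝ} (hf : Differentiable ℝ f) (y Δ : E) (τ : ℝ) :
    HasDerivAt (fun σ : ℝ => f (y + σ • Δ)) (fderiv ℝ f (y + τ • Δ) Δ) τ :=
  (hf (y + τ • Δ)).hasFDerivAt.comp_hasDerivAt τ (hasDerivAt_lineSegment y Δ τ)

/-- Along the segment, `τ ↦ Df(y + τΔ)Δ` has derivative `D²f(y + τΔ)[Δ, Δ]` (`f ∈ C²`). [folklore] -/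
theorem hasDerivAt_fderiv_comp_lineSegment {f : E → ℝ} (hf : ContDiff ℝ 2 f) (y Δ : E) (τ : ℝ) :
    HasDerivAt (fun σ : ℝ => fderiv ℝ f (y + σ • Δ) Δ)
      (fderiv ℝ (fderiv ℝ f) (y + τ • Δ) Δ Δ) τ := by
  have hd : Differentiable ℝ (fderiv ℝ f) :=
    (hf.fderiv_right (m := 1) (by norm_num)).differentiable one_ne_zero
  have h1 : HasDerivAt (fun σ : ℝ => fderiv ℝ f (y + σ • Δ)) (fderiv ℝ (fderiv ℝ f) (y + τ • Δ) Δ) τ :=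
    (hd (y + τ • Δ)).hasFDerivAt.comp_hasDerivAt τ (hasDerivAt_lineSegment y Δ τ)
  simpa using h1.clm_apply (hasDerivAt_const τ Δ)

/-- **Second-order Taylor expansion along a segment, oscillation form of the remainder.** For
`f ∈ C²` and `ε ≥ 0` with `‖D²f(y + σΔ) - D²f(y)‖ ≤ ε` for all `σ ∈ [0, 1]`:
`|f(y+Δ) - f(y) - Df(y)Δ - ½ D²f(y)[Δ,Δ]| ≤ ε ‖Δ‖²`. [folklore] -/
theorem taylor_two_segment {f : E → ℝ} (hf : ContDiff ℝ 2 f) (y Δ : E) {ε : ℝ}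
    (hosc : ∀ σ ∈ Icc (0 : ℝ) 1, ‖fderiv ℝ (fderiv ℝ f) (y + σ • Δ) - fderiv ℝ (fderiv ℝ f) y‖ ≤ ε) :
    |f (y + Δ) - f y - fderiv ℝ f y Δ - (1 / 2) * fderiv ℝ (fderiv ℝ f) y Δ Δ| ≤ ε * ‖Δ‖ ^ 2 := by
  have hε : 0 ≤ ε :=
    le_trans (norm_nonneg (fderiv ℝ (fderiv ℝ f) (y + (0 : ℝ) • Δ) - fderiv ℝ (fderiv ℝ f) y))
      (hosc 0 ⟨le_rfl, zero_le_one⟩)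
  have hd : Differentiable ℝ f := hf.differentiable (by norm_num)
  set g : ℝ → ℝ := fun σ => f (y + σ • Δ) with hg
  set g' : ℝ → ℝ := fun σ => fderiv ℝ f (y + σ • Δ) Δ with hg'
  set g'' : ℝ → ℝ := fun σ => fderiv ℝ (fderiv ℝ f) (y + σ • Δ) Δ Δ with hg''
  have hg1 : ∀ σ, HasDerivAt g (g' σ) σ := fun σ => hasDerivAt_comp_lineSegment hd y Δ σ
  have hg2 : ∀ σ, HasDerivAt g' (g'' σ) σ := fun σ => hasDerivAt_fderiv_comp_lineSegment hf y Δ σ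
  -- first mean value step: `|g'(τ) - g'(0) - τ g''(0)| ≤ ε ‖Δ‖² τ`
  set e : ℝ → ℝ := fun σ => g' σ - g' 0 - σ * g'' 0 with he
  have he_deriv : ∀ σ, HasDerivAt e (g'' σ - g'' 0) σ := fun σ => by
    have h1 : HasDerivAt (fun σ => g' σ - g' 0 - σ * g'' 0) (g'' σ - 1 * g'' 0) σ :=
      ((hg2 σ).sub_const (g' 0)).fun_sub ((hasDerivAt_id σ).mul_const (g'' 0))
    rw [one_mul] at h1
    exact h1
  have hbound'' : ∀ σ ∈ Ico (0 : ℝ) 1, ‖g'' σ - g'' 0‖ ≤ ε * ‖Δ‖ ^ 2 := by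
    intro σ hσ
    have h1 : g'' σ - g'' 0 = (fderiv ℝ (fderiv ℝ f) (y + σ • Δ) - fderiv ℝ (fderiv ℝ f) y) Δ Δ := by
      simp [hg'']
    rw [h1]
    calc ‖(fderiv ℝ (fderiv ℝ f) (y + σ • Δ) - fderiv ℝ (fderiv ℝ f) y) Δ Δ‖
        ≤ ‖(fderiv ℝ (fderiv ℝ f) (y + σ • Δ) - fderiv ℝ (fderiv ℝ f) y) Δ‖ * ‖Δ‖ :=
          ContinuousLinearMap.le_opNorm _ _
      _ ≤ ‖fderiv ℝ (fderiv ℝ f) (y + σ • Δ) - fderiv ℝ (fderiv ℝ f) y‖ * ‖Δ‖ * ‖Δ‖ :=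
          mul_le_mul_of_nonneg_right (ContinuousLinearMap.le_opNorm _ _) (norm_nonneg _)
      _ ≤ ε * ‖Δ‖ * ‖Δ‖ := by gcongr; exact hosc σ ⟨hσ.1, hσ.2.le⟩
      _ = ε * ‖Δ‖ ^ 2 := by ring
  have he_bound : ∀ σ ∈ Icc (0 : ℝ) 1, ‖e σ‖ ≤ ε * ‖Δ‖ ^ 2 := by
    intro σ hσ
    have h := norm_image_sub_le_of_norm_deriv_le_segment' (f := e) (f' := fun σ => g'' σ - g'' 0)
      (a := 0) (b := 1) (fun x _ => (he_deriv x).hasDerivWithinAt) hbound'' σ hσ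
    have he0 : e 0 = 0 := by simp [he]
    rw [he0, sub_zero, sub_zero] at h
    exact h.trans (mul_le_of_le_one_right (by positivity) hσ.2)
  -- second mean value step for `F(τ) = g(τ) - g(0) - τ g'(0) - τ² g''(0) / 2`, `F' = e`
  set F : ℝ → ℝ := fun σ => g σ - g 0 - σ * g' 0 - σ ^ 2 * g'' 0 / 2 with hF
  have hF_deriv : ∀ σ, HasDerivAt F (e σ) σ := fun σ => by
    have h1 : HasDerivAt (fun σ => g σ - g 0 - σ * g' 0 - σ ^ 2 * g'' 0 / 2)
        (g' σ - 1 * g' 0 - ((2 : ℕ) : ℝ) * σ ^ (2 - 1) * g'' 0 / 2) σ :=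
      (((hg1 σ).sub_const (g 0)).fun_sub ((hasDerivAt_id σ).mul_const (g' 0))).fun_sub
        (((hasDerivAt_pow 2 σ).mul_const (g'' 0)).div_const 2)
    have h2 : g' σ - 1 * g' 0 - ((2 : ℕ) : ℝ) * σ ^ (2 - 1) * g'' 0 / 2 = e σ := by
      simp [he]; ring
    rw [h2] at h1
    exact h1
  have h := norm_image_sub_le_of_norm_deriv_le_segment' (f := F) (f' := e) (a := 0) (b := 1)
    (fun x _ => (hF_deriv x).hasDerivWithinAt) (fun x hx => he_bound x ⟨hx.1, hx.2.le⟩) 1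
    ⟨zero_le_one, le_rfl⟩
  have hF0 : F 0 = 0 := by simp [hF]
  have hF1 : F 1 = f (y + Δ) - f y - fderiv ℝ f y Δ - (1 / 2) * fderiv ℝ (fderiv ℝ f) y Δ Δ := by
    simp [hF, hg, hg', hg'']; ring
  rw [hF0, sub_zero, sub_zero, mul_one, hF1, Real.norm_eq_abs] at h
  exact h


/-! ### `C²` functions with compact support: global bounds and a uniform remainder -/

omit [NormedSpace ℝ E] in
/-- A continuous function with compact support is bounded. [folklore] -/
theorem exists_forall_norm_le_of_hasCompactSupport {F : Type*} [NormedAddCommGroup F] {g : E → F}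
    (hg : Continuous g) (hc : HasCompactSupport g) : ∃ C, 0 ≤ C ∧ ∀ y, ‖g y‖ ≤ C := by
  obtain ⟨C, hC⟩ := hg.bounded_above_of_compact_support hc
  exact ⟨max C 0, le_max_right _ _, fun y => (hC y).trans (le_max_left _ _)⟩

/-- `f ∈ C¹_c`: `‖Df‖ ≤ M₁` globally. [folklore] -/
theorem exists_forall_norm_fderiv_le {f : E → ℝ} (hf : ContDiff ℝ 1 f) (hc : HasCompactSupport f) :
    ∃ M₁, 0 ≤ M₁ ∧ ∀ y, ‖fderiv ℝ f y‖ ≤ M₁ :=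
  exists_forall_norm_le_of_hasCompactSupport (hf.continuous_fderiv one_ne_zero) (hc.fderiv ℝ)

/-- `f ∈ C²_c`: `‖D²f‖ ≤ M₂` globally. [folklore] -/
theorem exists_forall_norm_fderiv_fderiv_le {f : E → ℝ} (hf : ContDiff ℝ 2 f) (hc : HasCompactSupport f) :
    ∃ M₂, 0 ≤ M₂ ∧ ∀ y, ‖fderiv ℝ (fderiv ℝ f) y‖ ≤ M₂ := by
  have h1 : ContDiff ℝ 1 (fderiv ℝ f) := hf.fderiv_right (m := 1) (by norm_num)
  exact exists_forall_norm_le_of_hasCompactSupport (h1.continuous_fderiv one_ne_zero) ((hc.fderiv ℝ).fderiv ℝ)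

/-- `f ∈ C²_c`: the second derivative is uniformly continuous. [folklore] -/
theorem uniformContinuous_fderiv_fderiv {f : E → ℝ} (hf : ContDiff ℝ 2 f) (hc : HasCompactSupport f) :
    UniformContinuous (fderiv ℝ (fderiv ℝ f)) := by
  have h1 : ContDiff ℝ 1 (fderiv ℝ f) := hf.fderiv_right (m := 1) (by norm_num)
  exact ((hc.fderiv ℝ).fderiv ℝ).uniformContinuous_of_continuous (h1.continuous_fderiv one_ne_zero)

/-- **Uniform second-order Taylor remainder for `C²_c` functions**: for every `ε > 0` there is
`ρ > 0` such that `|f(y+Δ) - f(y) - Df(y)Δ - ½D²f(y)[Δ,Δ]| ≤ ε‖Δ‖²` for ALL `y` and all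
`‖Δ‖ ≤ ρ`. [folklore] -/
theorem taylor_two_uniform {f : E → ℝ} (hf : ContDiff ℝ 2 f) (hc : HasCompactSupport f) {ε : ℝ}
    (hε : 0 < ε) :
    ∃ ρ, 0 < ρ ∧ ∀ y Δ : E, ‖Δ‖ ≤ ρ →
      |f (y + Δ) - f y - fderiv ℝ f y Δ - (1 / 2) * fderiv ℝ (fderiv ℝ f) y Δ Δ| ≤ ε * ‖Δ‖ ^ 2 := by
  obtain ⟨δ, hδ, hU⟩ := (Metric.uniformContinuous_iff (α := E) (β := E →L[ℝ] E →L[ℝ] ℝ)).1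
    (uniformContinuous_fderiv_fderiv hf hc) ε hε
  refine ⟨δ / 2, by positivity, fun y Δ hΔ => taylor_two_segment hf y Δ fun σ hσ => ?_⟩
  refine (le_of_lt ?_)
  have h := hU (a := y + σ • Δ) (b := y) ?_
  · exact lt_of_eq_of_lt (dist_eq_norm (fderiv ℝ (fderiv ℝ f) (y + σ • Δ)) (fderiv ℝ (fderiv ℝ f) y)).symm h
  rw [dist_eq_norm, add_sub_cancel_left, norm_smul, Real.norm_eq_abs, abs_of_nonneg hσ.1]
  calc σ * ‖Δ‖ ≤ 1 * ‖Δ‖ := mul_le_mul_of_nonneg_right hσ.2 (norm_nonneg _)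
    _ ≤ δ / 2 := by rw [one_mul]; exact hΔ
    _ < δ := by linarith

end Literature.Analysis.Calculus
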